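import Summits.ResolutionOfSingularities.ResolutionOfSingularities.Theorems.FrobeniusClosingPatchingRelPerfectMonomialRungTargets
import Summits.ResolutionOfSingularities.ResolutionOfSingularities.Theorems.FrobeniusClosingPatchingRelPerfectMonomialPairContraction
import HarnessLib

/-!
# Chain W5.2, TARGETS F3 (monomial rung «R-mono») — M3 `ClosedPointTower` CLOSED BY NAME

[OURS · L1 W5.2 · R-mono] Crux `PatchingRelPerfect` (stmt-ResolutionOfSingularities-16161), line
`closed_point_slice`. Planner file `ChainW52TargetsF3.lean` (res-L1-w52-plan-1 g6, sha16 164648b352fa9241) = tree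
module `…MonomialRungTargets.lean`; target M3 `DepthTargets.ClosedPointTower`: a multiple blow-up (`CentreSeq`)
whose centres lie over the closed point, on top of a blowing up of `Spec S` along a closed-point-supported ideal
sheaf, composes to ONE blowing up of `Spec S` along a closed-point-supported ideal sheaf. This is
res-L1-w52-stub-4's `MonomialCleanup.centreSeq_exists_isBlowup_comp_supported` (p501090, induction on the sequence
with the tree's `IsBlowup.exists_isBlowup_comp_supported`, Stacks 080B) at `Y = Spec S`, `T = {𝔪}`, up to binder
order. Fact-free. NOT a statement of the manuscript under review.

## References
* The Stacks Project, Tag 080B (compositions of blowings up of Noetherian schemes are blowings up). [StacksProject]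
-/

-- `Summit.<Summit>.<Sub>.Theorems` with `Sub = Summit` (single-conjunct summit, D-0017)
set_option linter.dupNamespace false

noncomputable section

open CategoryTheory AlgebraicGeometry
open Literature.AlgebraicGeometry.Resolution

namespace Summit.ResolutionOfSingularities.ResolutionOfSingularities.Theorems.DepthTargets

universe u

/-- **TARGET M3 `ClosedPointTower` holds** (res-L1-w52-stub-4's `MonomialCleanup.centreSeq_exists_isBlowup_comp_supported`
at `Y = Spec S`, `T = {closed point}`). [cite: StacksProject, Tag 080B] -/
theorem closedPointTower_holds : ClosedPointTower.{u} := by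
  intro S _ _ _ X g K₀ hg hK₀ s hs
  haveI : IsNoetherian (Spec (.of S)) := {}
  exact MonomialCleanup.centreSeq_exists_isBlowup_comp_supported s g {IsLocalRing.closedPoint S}
    ⟨K₀, hg, hK₀⟩ hs

end Summit.ResolutionOfSingularities.ResolutionOfSingularities.Theorems.DepthTargets

end
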